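import Summits.ResolutionOfSingularities.ResolutionOfSingularities.Theorems.WeightedInvariantIota3JSigmaDominanceUpgrade
import Summits.ResolutionOfSingularities.ResolutionOfSingularities.Theorems.WeightedInvariantP3tDrop
import HarnessLib

/-!
# (o70-b) PART 2b — (J-can)≤3 FROM ONE-SIDED DOMINANCE AT `q < r₂` (the conditional closer)
# (door `HypersurfaceCentreConstruction`, stmt-ResolutionOfSingularities-19897; clause h8 ⟸ (σ-pres)₃ ⟸ (o70-a) + (o70-b) + (o70-x);
# SPEC (Δ12) rev 2 `L/res-L1-w43-plan-1/JSigmaCanon_sketch.lean` aceffaa8e08fb006 of res-L1-w43-plan-1; hand res-D-brk-1)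

Topic: `Summits/ResolutionOfSingularities/ResolutionOfSingularities/Theorems`. Helper for the door item
`HypersurfaceCentreConstruction` (stmt-ResolutionOfSingularities-19897, route `WeightedInvariant`), line `local-engine`
(L W4.3), def-free (the SPEC (Δ12) words `JSigmaCanonicalAt`, `JSigmaCanonicalLE3Body` are INLINED verbatim).

* `Iota3.jSigmaCanonicalAt_of_oneSided` — at one regular local `(S, f)` (`0 ≠ f ∈ 𝔪`): (J-can) `JSigmaCanonicalAt f` follows from
  ONE-SIDED dominance of σ-maximisers sharing a primitive triple with `q < r₂`.  Assembly: (o70-w) `sigmaWeights_unique` (p561867)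
  makes the triples equal; `r₂ = q` is PART 1 `flagContactFiltration_eq_of_isSigmaMaximiser_of_r₂_eq_q'` (p564416, unconditional);
  `q < r₂` is the hypothesis upgraded by PART 2a `flagContactFiltration_eq_of_oneSided` (mutual dominance is automatic).
* `LocalEngine.jSigmaCanonicalLE3_of (p) (hdom)` — **(o70-b) `JSigmaCanonicalLE3Body p` MODULO the single binder `hdom`** = one-sided
  dominance at the LE3 point-centre positions (`dim S = 3`, `0 ≠ f ∈ 𝔪²`, top `(ν;ε;τ)`-stratum `= {𝔪}`, `ε ≠ 1`) for σ-maximisers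
  with the same primitive triple and `q < r₂`.  The binder is the honest residue of (o70-b) (PART 2c attacks it).

[OURS · L1 W4.3 · (o70-b) PART 2b]  Replaces the role of NO printed item; NOT a statement of the manuscript
[claim: Hironaka2017, status: under-review]. AI work, weaker than expert review.  No named facts; `hdom` is an explicit hypothesis.
-/

noncomputable section

set_option linter.dupNamespace false -- mandated namespace `Summit.<Summit>.<Problem>` of this single-conjunct summit

open IsLocalRing Literature.AlgebraicGeometry.Resolution
open Summit.ResolutionOfSingularities.ResolutionOfSingularities.Theorems

namespace Summit.ResolutionOfSingularities.ResolutionOfSingularities.Cruxes.HypersurfaceCentreConstruction.LocalEngine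

namespace Iota3

variable {S : Type} [CommRing S] [IsRegularLocalRing S]

/-- **(J-can) at one `(S, f)` from one-sided dominance at `q < r₂`.**  For `0 ≠ f ∈ 𝔪` in a regular local ring: if for all σ-maximisers
`(g₁, g₂)`, `(g₁', g₂')` of `f` at `ν = ord f` with the same primitive triple `(q; r₁, r₂)`, `q < r₂`, the first sits in the second's
filtration (`g₁ ∈ F'(r₁)`, `g₂ ∈ F'(r₂)`), then ANY two σ-maximisers with primitive triples carry the same filtration — the body of
SPEC (Δ12) `JSigmaCanonicalAt f`, inlined. [OURS · L1 W4.3 · (o70-b)] -/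
theorem jSigmaCanonicalAt_of_oneSided {f : S} (hf0 : f ≠ 0) (hfm : f ∈ maximalIdeal S)
    (hdom : ∀ (g₁ g₂ g₁' g₂' : S) (q r₁ r₂ : ℕ),
      IsSigmaMaximiser f (adicOrder f).toNat g₁ g₂ q r₁ r₂ → IsPrimitiveTriple q r₁ r₂ →
      IsSigmaMaximiser f (adicOrder f).toNat g₁' g₂' q r₁ r₂ → q < r₂ →
      g₁ ∈ flagContactFiltration g₁' g₂' q r₁ r₂ r₁ ∧ g₂ ∈ flagContactFiltration g₁' g₂' q r₁ r₂ r₂) :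
    ∀ (g₁ g₂ : S) (q r₁ r₂ : ℕ) (g₁' g₂' : S) (q' r₁' r₂' : ℕ),
      IsSigmaMaximiser f (adicOrder f).toNat g₁ g₂ q r₁ r₂ → IsPrimitiveTriple q r₁ r₂ →
      IsSigmaMaximiser f (adicOrder f).toNat g₁' g₂' q' r₁' r₂' → IsPrimitiveTriple q' r₁' r₂' →
      ∀ m : ℕ, flagContactFiltration g₁' g₂' q' r₁' r₂' m = flagContactFiltration g₁ g₂ q r₁ r₂ m := by
  intro g₁ g₂ q r₁ r₂ g₁' g₂' q' r₁' r₂' hmax hprim hmax' hprim' m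
  obtain ⟨rfl, rfl, rfl⟩ := sigmaWeights_unique hmax hprim hmax' hprim'
  rcases (hmax.1.2.1 : q' ≤ r₂').eq_or_lt with h | h
  · exact flagContactFiltration_eq_of_isSigmaMaximiser_of_r₂_eq_q' hf0 hfm hmax hprim hmax' hprim' h.symm m
  · obtain ⟨h₁, h₂⟩ := hdom g₁ g₂ g₁' g₂' q' r₁' r₂' hmax hprim hmax' h
    exact flagContactFiltration_eq_of_oneSided hmax.2.1 hmax.1 hmax'.2.1.1 hmax'.2.1.2.1 h₁ h₂ m

end Iota3

open Iota3 in
/-- **(o70-b) `JSigmaCanonicalLE3Body p` MODULO ONE-SIDED DOMINANCE AT `q < r₂`** (SPEC (Δ12) rev 2 l.121, body inlined verbatim):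
for every regular local `S` essentially of finite type over a perfect field of characteristic `p`, `dim S = 3`, `0 ≠ f ∈ 𝔪²`, top
`(ν;ε;τ)`-stratum the closed point and `ε ≠ 1`, any two σ-attaining primitive two-flags of `f` have the same filtration at every level —
GIVEN the binder `hdom`: at these positions a σ-maximiser sits inside the filtration of any other σ-maximiser with the same primitive
triple and `q < r₂`.  (`r₂ = q` is unconditional, PART 1 p564416; mutuality is automatic, PART 2a.) [OURS · L1 W4.3 · (o70-b)] -/
theorem jSigmaCanonicalLE3_of (p : ℕ)
    (hdom : ∀ (k₀ : Type) [Field k₀] [CharP k₀ p] [PerfectField k₀]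
      (S : Type) [CommRing S] [Algebra k₀ S] [Algebra.EssFiniteType k₀ S] [IsRegularLocalRing S] (f : S),
      ringKrullDim S = (3 : ℕ) → f ≠ 0 → f ∈ (maximalIdeal S) ^ 2 →
      ContactCylinder.topStratumPrime iotaOrdEpsTau S f = maximalIdeal S → iotaEps S f ≠ 1 →
      ∀ (g₁ g₂ g₁' g₂' : S) (q r₁ r₂ : ℕ),
        IsSigmaMaximiser f (adicOrder f).toNat g₁ g₂ q r₁ r₂ → IsPrimitiveTriple q r₁ r₂ →
        IsSigmaMaximiser f (adicOrder f).toNat g₁' g₂' q r₁ r₂ → q < r₂ →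
        g₁ ∈ flagContactFiltration g₁' g₂' q r₁ r₂ r₁ ∧ g₂ ∈ flagContactFiltration g₁' g₂' q r₁ r₂ r₂) :
    ∀ (k₀ : Type) [Field k₀] [CharP k₀ p] [PerfectField k₀]
      (S : Type) [CommRing S] [Algebra k₀ S] [Algebra.EssFiniteType k₀ S] [IsRegularLocalRing S] (f : S),
      ringKrullDim S = (3 : ℕ) → f ≠ 0 → f ∈ (maximalIdeal S) ^ 2 →
      ContactCylinder.topStratumPrime iotaOrdEpsTau S f = maximalIdeal S → iotaEps S f ≠ 1 →
      ∀ (g₁ g₂ : S) (q r₁ r₂ : ℕ) (g₁' g₂' : S) (q' r₁' r₂' : ℕ),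
        IsSigmaMaximiser f (adicOrder f).toNat g₁ g₂ q r₁ r₂ → IsPrimitiveTriple q r₁ r₂ →
        IsSigmaMaximiser f (adicOrder f).toNat g₁' g₂' q' r₁' r₂' → IsPrimitiveTriple q' r₁' r₂' →
        ∀ m : ℕ, flagContactFiltration g₁' g₂' q' r₁' r₂' m = flagContactFiltration g₁ g₂ q r₁ r₂ m := by
  intro k₀ _ _ _ S _ _ _ _ f hdim hf0 hf2 htop hε
  exact jSigmaCanonicalAt_of_oneSided hf0 (Ideal.pow_le_self two_ne_zero hf2)
    (hdom k₀ S f hdim hf0 hf2 htop hε)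

end Summit.ResolutionOfSingularities.ResolutionOfSingularities.Cruxes.HypersurfaceCentreConstruction.LocalEngine

end
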